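import Summits.QuantumFields.YangMills.Theorems.BalabanUVNodesN15FullPropagatorV1XCovAllTwoSidedNode
import Summits.QuantumFields.YangMills.Theorems.BalabanUVNodesN15FullPropagatorSizedN15At
import Summits.QuantumFields.YangMills.Theorems.BalabanUVNodesN15PairedFamilyGuard
import HarnessLib

/-!
# THE SIZED (GUARD-LIVE) EDITION OF THE GAUGE-DRESSED FULL-PROPAGATOR FAMILIES `v1X` ∕ `v1XC` ∕ `v1XA`: Bałaban's size parameter `M ≥ 1` as a FREE index, the (3.35) window
# re-parametrised `α₀ ↦ Mα₀`, and `NE2PlusOperator` ∕ `NE2PlusOperatorM1` on a family COFINAL in `gf.M` and `gc.k` (dag-n15-c g10, FILE 40; Track-A node N15 = NE2, s1)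

`--kind definition --supports stmt-QuantumFields-20544 --as helper` (K3⁷; count-neutral).  Imports BY NAME this seat's FILE 38 `…FullPropagatorV1XCovAllTwoSidedNode` (through it FILES 39∕35∕30∕27:
`NE2PlusOperatorM1`, `fgInstanceV1G`, `fgFamilyV1X`, `fgFamilyV1XC`, `fgFamilyV1XA` and their torus theorems) and dag-n15-a part 82 `…FullPropagatorSizedN15At` (`TGIndexS`, `tgIndexS_cofinal` —
the sized index of record; `VectorPiece.unitTorusGeoS` — the sized [B6] carrier) and dag-n15-w2 `…N15PairedFamilyGuard` ((J2) `ne2PlusOperator_of_gf_M_lt`, by name in §4); nothing in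
the tree is modified or re-declared.

WHY.  Referee ref-F g16 FLAG-VACUITY-A1 ∕ ref-B g24 CONCUR (pub-ymgap INBOX l.24583 ∕ l.24707): on the unit-torus instances `(fgInstanceV1G …).gf.M = 1`, so the printed-template
`NE2PlusOperator` (`∃ M₅ > 0, ∀ i, M₅ ≤ gf.M → …`) is vacuous as typed (`M₅ := 2`).  FILE 39 gave the guard-free shape `NE2PlusOperatorM1` (honest form (b-i) of ref-B's record).  THIS
file gives the OTHER honest form (b-ii): realise the size parameter.  On the sized carrier `unitTorusGeoS … M` the letter carrier `v1GaugeBg … M` has the (3.35) window `‖A′‖ ≤ c₃₅Mα₀`,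
`‖∂A′‖ ≤ c₃₅Mα₀η′`, `‖∂²A′‖ ≤ c₃₅Mα₀η′²` — which IS the `M = 1` window at `α₀′ := Mα₀` (§1 `reg335_v1GaugeBg_size_iff`); the operators do not see `M`; and the printed clause
`gf.M·α₀ ≤ a₀` is exactly `α₀′ ≤ a₀`.  So every `M = 1` theorem of FILES 39∕35∕38 TRANSPORTS to the sized family (§3), where the guard `M₅ ≤ gf.M = M` is LIVE: the family is cofinal
in `M` and in `k` (§2 `fgInstanceV1GS_cofinal`, the shape of n15-w2's `PairedFamilyGuard.Live.cofinal`), hence NO bounded-`M` witness `M₅ := sup M + 1` exists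
(`not_exists_gf_M_lt_fgInstanceV1GS`).

WHAT.  §1 `reg335_v1GaugeBg_size_iff`.  §2 `fgInstanceV1GS` (sized instance on `TGIndexS × Fin (d+1)`), `fgInstanceV1GS_gf_M` ∕ `_gc_M` ∕ `_gc_k` (`rfl`), ★ `fgInstanceV1GS_cofinal`,
`not_exists_gf_M_lt_fgInstanceV1GS`, `reg335_fgInstanceV1GS_iff` (the re-parametrisation at the instance), `reg335_fgInstanceV1GS_const` (the window is inhabited), the three transported kernel families `fgFamilyV1XS` ∕ `fgFamilyV1XCS` ∕
`fgFamilyV1XAS` (FILE 30's exact-species two-sided family; FILE 35's with covariant entries 1,3; FILE 38's with all four entries covariant — VERBATIM at the underlying index, field by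
field as in part 82 `tgFamilyS`) with their `etaRateIneq342_…_iff` (`Iff.rfl`).  §3 ★★ `ne2PlusOperatorM1_of_unsized` (the transport lemma: an `M = 1` statement on `fgInstanceV1G` gives
the sized one), ★★★ **`ne2PlusOperatorM1_fullGM₂_v1XS`**, ★★★ **`ne2PlusOperator_fullGM₂_v1XS : NE2PlusOperator c₃₅ (fgInstanceV1GS d 𝔄 ι hL) (fgFamilyV1XS d 𝔄 ι e hL b)`** — the
printed-template statement on a family where `M₅ ≤ gf.M` excludes nothing uniformly — and the same pair for `v1XC` and `v1XA`; `_dim4` corollaries.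
§4 TEETH (bookkeeping): `constOneFamily`, `not_etaRateIneq342_constOne`; `ne2PlusOperator_fgInstanceV1G_any` (the flagged vacuity BY NAME: n15-w2 (J2) `ne2PlusOperator_of_gf_M_lt`
at `M₅ := 2`) versus ★ `exists_not_ne2PlusOperatorM1_fgInstanceV1G` (FILE 39's shape is violated by some kernel family) and ★★ `exists_not_ne2PlusOperator_fgInstanceV1GS` (on the SIZED
family the printed-template shape itself is violated by some kernel family — §3 certifies an estimate at the type level), `exists_not_ne2PlusOperatorM1_fgInstanceV1GS`.

HONEST FRAMING.  Transport∕bookkeeping only (no new estimate): the estimates are FILES 30∕35∕38's (through 39's M1 shape), uniform in `M` because `M` enters only the window.  Model-level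
items exactly as in FILES 30∕32∕35∕38 (linearised block-mean pairing (C3); `U ≡ 1` base point of the dressing; Bałaban's `V′₁` with the EXACT second-order species of FILE 28; no
Q-words∕P-words).  NE2⁺ as printed NOT PRINTED; count-neutral; N15 NOT discharged; finite tori at fixed ε — NOT ℝ⁴, NOT infinite volume, NOT OS, NOT a mass gap, NOT Clay.
-/

noncomputable section

open scoped BigOperators
open Finset

namespace Summit.QuantumFields.YangMills.BalabanUVNodes.N15.BackgroundLayer

open Literature.MathematicalPhysics.QuantumFieldTheory.Balaban1983to89
open Literature.MathematicalPhysics.QuantumFieldTheory.Balaban1983to89.T4EtaRate (PairedInstance EtaPairing EtaRateIneq342 NE2PlusOperator)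
open Literature.MathematicalPhysics.QuantumFieldTheory.Balaban1983to89.B5Prop11Plancherel (Tor fine)
open Literature.MathematicalPhysics.QuantumFieldTheory.Balaban1983to89.B6UnitTorusCarrier (unitTorusGeo)
open Summit.QuantumFields.YangMills.BalabanUVNodes.N15.OperatorReadout (opGeo)
open Summit.QuantumFields.YangMills.BalabanUVNodes.N15.TwoGrid (TGIndex TGIndex.Mn)
open Summit.QuantumFields.YangMills.BalabanUVNodes.N15.VectorPiece (blkFine kingPrV bshiftEquiv unitTorusGeoS)
open Summit.QuantumFields.YangMills.BalabanUVNodes.N15.GenuineRecord (TGIndexS tgIndexS_cofinal tgIndexS_nonempty)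

variable {d : ℕ}

/-! ## §1 The (3.35) window of the letter carrier at size `M` IS the `M = 1` window at `Mα₀` -/

section Window

variable (𝔄 : Type) [NormedRing 𝔄] {X J : Type}

/-- **SIZE RE-PARAMETRISATION OF (3.35)**: `Reg335` of `v1GaugeBg … M` at `(c, α₀)` is `Reg335` of `v1GaugeBg … 1` at `(c, Mα₀)` — the size parameter enters the letter carrier only
through the product `Mα₀`. [cite: Balaban1985BackgroundPropagators, (3.35) p.396 (the window `|A′| ≤ C·Mα₀` etc.)] -/
theorem reg335_v1GaugeBg_size_iff (s : J → X ≃ X) (η M c α₀ : ℝ) (A : J → X → 𝔄) :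
    (v1GaugeBg 𝔄 J s η M).Reg335 c α₀ A ↔ (v1GaugeBg 𝔄 J s η 1).Reg335 c (M * α₀) A := by
  simp only [reg335_v1GaugeBg_iff, mul_one, mul_assoc]

end Window

/-! ## §2 The sized instance, its liveness, the window transport and the transported kernel families -/

section Sized

variable {L : ℕ} [NeZero L]
variable (d) (𝔄 : Type) [NormedRing 𝔄] [NormedAlgebra ℝ 𝔄] [CompleteSpace 𝔄] (ι : Type) [Fintype ι] [DecidableEq ι] [Nonempty ι] (e : 𝔄 ≃L[ℝ] (ι → ℝ))

/-- The underlying (unsized) index of a sized index-with-direction. [folklore] -/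
def sizedBase (j : TGIndexS × Fin (d + 1)) : TGIndex × Fin (d + 1) := (j.1.toTGIndex, j.2)

/-- THE SIZED REALISED PAIRED INSTANCE at `(j, ν)`: FILE 27's `fgInstanceV1G` with the [B6] unit-torus carrier replaced by dag-n15-a's SIZED carrier `unitTorusGeoS … j.Msz` (every
other field unchanged) and the letter carriers `v1GaugeBg` read at size `M = j.Msz` (the (3.35) window `C·Mα₀`). [cite: Balaban1985BackgroundPropagators, Thm 3.14 pp.426–427
(typing template); (3.35)–(3.36) p.396 (the size parameter `M` of the window)] -/
def fgInstanceV1GS (hL : Odd L ∧ 1 < L) (j : TGIndexS × Fin (d + 1)) : PairedInstance :=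
  bgInstanceM₂R (ι := ι) (g := unitTorusGeoS L j.1.k (TGIndex.Mn d hL j.1.toTGIndex) j.1.Msz) (blkFine L j.1.k (TGIndex.Mn d hL j.1.toTGIndex))
    (kingPrV L j.1.k j.1.m (TGIndex.Mn d hL j.1.toTGIndex)) j.1.m
    (v1GaugeBg 𝔄 (Fin (d + 1)) (fun μ => bshiftEquiv (TGIndex.Mn d hL j.1.toTGIndex) (L ^ j.1.k) μ) (unitTorusGeoS L j.1.k (TGIndex.Mn d hL j.1.toTGIndex) j.1.Msz).eta
      (unitTorusGeoS L j.1.k (TGIndex.Mn d hL j.1.toTGIndex) j.1.Msz).M)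
    (v1GaugeBg 𝔄 (Fin (d + 1)) (fun μ => bshiftEquiv (TGIndex.Mn d hL j.1.toTGIndex) (L ^ j.1.m * L ^ j.1.k) μ)
      ((unitTorusGeoS L j.1.k (TGIndex.Mn d hL j.1.toTGIndex) j.1.Msz).eta * ((unitTorusGeoS L j.1.k (TGIndex.Mn d hL j.1.toTGIndex) j.1.Msz).L ^ j.1.m)⁻¹)
      (unitTorusGeoS L j.1.k (TGIndex.Mn d hL j.1.toTGIndex) j.1.Msz).M)
    (v1GaugePairing 𝔄 (Fin (d + 1)) ι (g := unitTorusGeoS L j.1.k (TGIndex.Mn d hL j.1.toTGIndex) j.1.Msz) (blkFine L j.1.k (TGIndex.Mn d hL j.1.toTGIndex))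
      (kingPrV L j.1.k j.1.m (TGIndex.Mn d hL j.1.toTGIndex)) (fun μ => bshiftEquiv (TGIndex.Mn d hL j.1.toTGIndex) (L ^ j.1.k) μ)
      (fun μ => bshiftEquiv (TGIndex.Mn d hL j.1.toTGIndex) (L ^ j.1.m * L ^ j.1.k) μ) j.1.m (Nat.cast_ne_zero.mpr (NeZero.ne L)))

omit [CompleteSpace 𝔄] [DecidableEq ι] [Nonempty ι] in
/-- **THE GUARD IS LIVE — the fine geometry's size field IS the index's `M`** (the printed clause `M₅ ≤ (pi j).gf.M` reads `M₅ ≤ j.Msz`). [folklore] -/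
theorem fgInstanceV1GS_gf_M (hL : Odd L ∧ 1 < L) (j : TGIndexS × Fin (d + 1)) : (fgInstanceV1GS d 𝔄 ι hL j).gf.M = j.1.Msz := rfl

omit [CompleteSpace 𝔄] [DecidableEq ι] [Nonempty ι] in
/-- The operator geometry's size field IS the index's `M`. [folklore] -/
theorem fgInstanceV1GS_gc_M (hL : Odd L ∧ 1 < L) (j : TGIndexS × Fin (d + 1)) : (fgInstanceV1GS d 𝔄 ι hL j).gc.M = j.1.Msz := rfl

omit [CompleteSpace 𝔄] [DecidableEq ι] [Nonempty ι] in
/-- The operator geometry's number of scales IS the index's `k`. [folklore] -/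
theorem fgInstanceV1GS_gc_k (hL : Odd L ∧ 1 < L) (j : TGIndexS × Fin (d + 1)) : (fgInstanceV1GS d 𝔄 ι hL j).gc.k = j.1.k := rfl

omit [CompleteSpace 𝔄] [DecidableEq ι] [Nonempty ι] in
/-- `1 ≤ gf.M` on the sized family (the index carries `1 ≤ M`). [folklore] -/
theorem one_le_fgInstanceV1GS_gf_M (hL : Odd L ∧ 1 < L) (j : TGIndexS × Fin (d + 1)) : 1 ≤ (fgInstanceV1GS d 𝔄 ι hL j).gf.M := j.1.one_le_Msz

omit [CompleteSpace 𝔄] [DecidableEq ι] [Nonempty ι] in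
/-- ★ **THE SIZED FAMILY IS COFINAL IN THE SIZE AND IN THE NUMBER OF SCALES** (the two `cofinal` clauses of n15-w2's `PairedFamilyGuard.Live`, at every direction `ν`): for every
`M₅` and `k₀` some index has `M₅ ≤ gf.M` and `k₀ ≤ gc.k` — the printed guard «for `M ≥ M₅`» excludes nothing uniformly here. [folklore] -/
theorem fgInstanceV1GS_cofinal (hL : Odd L ∧ 1 < L) (ν : Fin (d + 1)) (M₅ : ℝ) (k₀ : ℕ) :
    ∃ j : TGIndexS × Fin (d + 1), j.2 = ν ∧ M₅ ≤ (fgInstanceV1GS d 𝔄 ι hL j).gf.M ∧ k₀ ≤ (fgInstanceV1GS d 𝔄 ι hL j).gc.k := by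
  obtain ⟨j, hM, hk⟩ := tgIndexS_cofinal M₅ k₀
  exact ⟨(j, ν), rfl, hM, hk⟩

omit [CompleteSpace 𝔄] [DecidableEq ι] [Nonempty ι] in
/-- **NO BOUNDED-`M` WITNESS**: there is no `M₅` with `gf.M < M₅` at every index — so the `M₅ := sup M + 1` proof of `NE2PlusOperator` (ref-F's probe on the `M ≡ 1` family) is NOT
available on the sized family. [folklore] -/
theorem not_exists_gf_M_lt_fgInstanceV1GS (hL : Odd L ∧ 1 < L) : ¬ ∃ M₅ : ℝ, ∀ j : TGIndexS × Fin (d + 1), (fgInstanceV1GS d 𝔄 ι hL j).gf.M < M₅ := by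
  rintro ⟨M₅, h⟩
  obtain ⟨j, -, hM, -⟩ := fgInstanceV1GS_cofinal d 𝔄 ι hL 0 M₅ 0
  exact absurd (h j) (not_lt.mpr hM)

omit [CompleteSpace 𝔄] [DecidableEq ι] [Nonempty ι] in
/-- **THE WINDOW TRANSPORT AT THE INSTANCE**: a fine configuration is (3.35)-regular at `(c, α₀)` for the SIZED instance iff it is regular at `(c, Mα₀)` for FILE 27's `M = 1` instance at
the underlying index. [cite: Balaban1985BackgroundPropagators, (3.35) p.396 (the window)] -/
theorem reg335_fgInstanceV1GS_iff (hL : Odd L ∧ 1 < L) (j : TGIndexS × Fin (d + 1)) (c α₀ : ℝ) (A : (fgInstanceV1GS d 𝔄 ι hL j).Bf.Cfg) :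
    (fgInstanceV1GS d 𝔄 ι hL j).Bf.Reg335 c α₀ A ↔ (fgInstanceV1G d 𝔄 ι hL (sizedBase d j)).Bf.Reg335 c (j.1.Msz * α₀) A :=
  reg335_v1GaugeBg_size_iff 𝔄 _ _ _ _ _ _

omit [CompleteSpace 𝔄] [DecidableEq ι] [Nonempty ι] in
/-- **THE WINDOW IS INHABITED AT EVERY SIZE**: a constant field `A′ ≡ a` with `‖a‖ ≤ c₃₅·M·α₀` is (3.35)-regular at `(c₃₅, α₀)` for the sized instance (FILE 39 §4 transported) — so for
`𝔄 ≠ 0` the ∀-blocks of the §3 statements are met by non-zero configurations at every index and every `α₀ ∈ (0, a₀/M]`. [folklore] -/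
theorem reg335_fgInstanceV1GS_const (hL : Odd L ∧ 1 < L) (j : TGIndexS × Fin (d + 1)) {c35 α₀ : ℝ} (hc35 : 0 ≤ c35) (hα₀ : 0 ≤ α₀) (a : 𝔄) (ha : ‖a‖ ≤ c35 * (j.1.Msz * α₀)) :
    (fgInstanceV1GS d 𝔄 ι hL j).Bf.Reg335 c35 α₀
      (fun (_ : Fin (d + 1)) (_ : Tor (fine (L ^ j.1.m * L ^ j.1.k) (TGIndex.Mn d hL j.1.toTGIndex)) × Fin (d + 1)) => a) :=
  (reg335_fgInstanceV1GS_iff d 𝔄 ι hL j c35 α₀ _).mpr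
    (reg335_fgInstanceV1G_const d 𝔄 ι hL (sizedBase d j) hc35 (mul_nonneg (le_trans zero_le_one j.1.one_le_Msz) hα₀) a ha)

/-- THE SIZED EXACT-SPECIES TWO-SIDED FAMILY: FILE 30's `fgFamilyV1X` at the underlying index VERBATIM (field by field; the size field enters nowhere).
[cite: Balaban1985BackgroundPropagators, (3.42) p.397 + (3.52) p.400 (shapes)] -/
def fgFamilyV1XS (hL : Odd L ∧ 1 < L) (b : ℝ) (j : TGIndexS × Fin (d + 1)) : B9.KernelFamily (fgInstanceV1GS d 𝔄 ι hL j).gc (fgInstanceV1GS d 𝔄 ι hL j).Bf :=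
  ⟨(fgFamilyV1X d 𝔄 ι e hL b (sizedBase d j)).e, (fgFamilyV1X d 𝔄 ι e hL b (sizedBase d j)).h1, (fgFamilyV1X d 𝔄 ι e hL b (sizedBase d j)).e4,
    (fgFamilyV1X d 𝔄 ι e hL b (sizedBase d j)).h2, (fgFamilyV1X d 𝔄 ι e hL b (sizedBase d j)).l2, (fgFamilyV1X d 𝔄 ι e hL b (sizedBase d j)).glob⟩

/-- THE SIZED FAMILY WITH COVARIANT ENTRIES 1, 3: FILE 35's `fgFamilyV1XC` at the underlying index VERBATIM. [cite: Balaban1985BackgroundPropagators, (3.42) p.397 (shape)] -/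
def fgFamilyV1XCS (hL : Odd L ∧ 1 < L) (b : ℝ) (j : TGIndexS × Fin (d + 1)) : B9.KernelFamily (fgInstanceV1GS d 𝔄 ι hL j).gc (fgInstanceV1GS d 𝔄 ι hL j).Bf :=
  ⟨(fgFamilyV1XC d 𝔄 ι e hL b (sizedBase d j)).e, (fgFamilyV1XC d 𝔄 ι e hL b (sizedBase d j)).h1, (fgFamilyV1XC d 𝔄 ι e hL b (sizedBase d j)).e4,
    (fgFamilyV1XC d 𝔄 ι e hL b (sizedBase d j)).h2, (fgFamilyV1XC d 𝔄 ι e hL b (sizedBase d j)).l2, (fgFamilyV1XC d 𝔄 ι e hL b (sizedBase d j)).glob⟩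

/-- THE SIZED FAMILY WITH ALL FOUR ENTRIES COVARIANT: FILE 38's `fgFamilyV1XA` at the underlying index VERBATIM. [cite: Balaban1985BackgroundPropagators, (3.42) p.397 (shape)] -/
def fgFamilyV1XAS (hL : Odd L ∧ 1 < L) (b : ℝ) (j : TGIndexS × Fin (d + 1)) : B9.KernelFamily (fgInstanceV1GS d 𝔄 ι hL j).gc (fgInstanceV1GS d 𝔄 ι hL j).Bf :=
  ⟨(fgFamilyV1XA d 𝔄 ι e hL b (sizedBase d j)).e, (fgFamilyV1XA d 𝔄 ι e hL b (sizedBase d j)).h1, (fgFamilyV1XA d 𝔄 ι e hL b (sizedBase d j)).e4,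
    (fgFamilyV1XA d 𝔄 ι e hL b (sizedBase d j)).h2, (fgFamilyV1XA d 𝔄 ι e hL b (sizedBase d j)).l2, (fgFamilyV1XA d 𝔄 ι e hL b (sizedBase d j)).glob⟩

omit [CompleteSpace 𝔄] [Nonempty ι] in
/-- The (3.42) inequality for the sized `v1X` family at `j` IS the inequality for FILE 30's family at the underlying index. [folklore] -/
theorem etaRateIneq342_fgFamilyV1XS_iff (hL : Odd L ∧ 1 < L) (b : ℝ) (j : TGIndexS × Fin (d + 1)) (B δ γ : ℝ) (A : (fgInstanceV1GS d 𝔄 ι hL j).Bf.Cfg) :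
    EtaRateIneq342 (fgFamilyV1XS d 𝔄 ι e hL b j) B δ γ A ↔ EtaRateIneq342 (fgFamilyV1X d 𝔄 ι e hL b (sizedBase d j)) B δ γ A :=
  Iff.rfl

omit [CompleteSpace 𝔄] [Nonempty ι] in
/-- The (3.42) inequality for the sized `v1XC` family at `j` IS the inequality for FILE 35's family at the underlying index. [folklore] -/
theorem etaRateIneq342_fgFamilyV1XCS_iff (hL : Odd L ∧ 1 < L) (b : ℝ) (j : TGIndexS × Fin (d + 1)) (B δ γ : ℝ) (A : (fgInstanceV1GS d 𝔄 ι hL j).Bf.Cfg) :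
    EtaRateIneq342 (fgFamilyV1XCS d 𝔄 ι e hL b j) B δ γ A ↔ EtaRateIneq342 (fgFamilyV1XC d 𝔄 ι e hL b (sizedBase d j)) B δ γ A :=
  Iff.rfl

omit [CompleteSpace 𝔄] [Nonempty ι] in
/-- The (3.42) inequality for the sized `v1XA` family at `j` IS the inequality for FILE 38's family at the underlying index. [folklore] -/
theorem etaRateIneq342_fgFamilyV1XAS_iff (hL : Odd L ∧ 1 < L) (b : ℝ) (j : TGIndexS × Fin (d + 1)) (B δ γ : ℝ) (A : (fgInstanceV1GS d 𝔄 ι hL j).Bf.Cfg) :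
    EtaRateIneq342 (fgFamilyV1XAS d 𝔄 ι e hL b j) B δ γ A ↔ EtaRateIneq342 (fgFamilyV1XA d 𝔄 ι e hL b (sizedBase d j)) B δ γ A :=
  Iff.rfl

end Sized

/-! ## §3 The transport lemma and the sized NE2⁺ operator-layer theorems -/

section Transport

variable {L : ℕ} [NeZero L]
variable (d) (𝔄 : Type) [NormedRing 𝔄] [NormedAlgebra ℝ 𝔄] [CompleteSpace 𝔄] (ι : Type) [Fintype ι] [DecidableEq ι] [Nonempty ι] (e : 𝔄 ≃L[ℝ] (ι → ℝ))

omit [CompleteSpace 𝔄] [DecidableEq ι] [Nonempty ι] in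
/-- ★★ **THE TRANSPORT LEMMA**: let `Kd` be a kernel family on FILE 27's `M = 1` instances and `KdS` a kernel family on the sized instances whose (3.42) inequality at `j` is the one of
`Kd` at the underlying index.  Then `NE2PlusOperatorM1` for `Kd` gives `NE2PlusOperatorM1` for `KdS` with the SAME constants: at a sized index with `Mα₀ ≤ a₀` and `A′` regular at
`(c₃₅, α₀)` (size-`M` window), `A′` is regular at `(c₃₅, Mα₀)` for the `M = 1` carrier (§1) and `1·(Mα₀) ≤ a₀`. [folklore] -/
theorem ne2PlusOperatorM1_of_unsized (hL : Odd L ∧ 1 < L) (c35 : ℝ) (Kd : ∀ i, B9.KernelFamily (fgInstanceV1G d 𝔄 ι hL i).gc (fgInstanceV1G d 𝔄 ι hL i).Bf)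
    (KdS : ∀ j, B9.KernelFamily (fgInstanceV1GS d 𝔄 ι hL j).gc (fgInstanceV1GS d 𝔄 ι hL j).Bf)
    (hK : ∀ j B δ γ (A : (fgInstanceV1GS d 𝔄 ι hL j).Bf.Cfg), EtaRateIneq342 (Kd (sizedBase d j)) B δ γ A → EtaRateIneq342 (KdS j) B δ γ A)
    (h : NE2PlusOperatorM1 c35 (fgInstanceV1G d 𝔄 ι hL) Kd) : NE2PlusOperatorM1 c35 (fgInstanceV1GS d 𝔄 ι hL) KdS := by
  obtain ⟨δ₀, a₀, B₀, γ, hδ₀, ha₀, hB₀, hγ, H⟩ := h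
  refine ⟨δ₀, a₀, B₀, γ, hδ₀, ha₀, hB₀, hγ, fun j α₀ hα₀ hαa A hA => ?_⟩
  have hMS : (fgInstanceV1GS d 𝔄 ι hL j).gf.M = j.1.Msz := rfl
  have hM1 : (fgInstanceV1G d 𝔄 ι hL (sizedBase d j)).gf.M = 1 := rfl
  have hM0 : 0 < j.1.Msz := lt_of_lt_of_le one_pos j.1.one_le_Msz
  rw [hMS] at hαa
  refine hK j B₀ δ₀ γ A (H (sizedBase d j) (j.1.Msz * α₀) (mul_pos hM0 hα₀) (by rw [hM1, one_mul]; exact hαa) A ?_)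
  exact (reg335_fgInstanceV1GS_iff d 𝔄 ι hL j c35 α₀ A).mp hA

/-- ★★★ **NE2⁺ OPERATOR LAYER, GUARD-FREE SHAPE, ON THE SIZED FAMILY — exact-species two-sided family `v1X`** (FILE 39 `ne2PlusOperatorM1_fullGM₂_v1X` transported; hypothesis-free).
[cite: Balaban1985BackgroundPropagators, Thm 3.1 (3.42) p.397 + Thm 3.14 pp.426–427 (template); Balaban1984PropagatorsI, Prop. 1.2 p.35; King1986, Prop. 3.9 (3.73) p.665] -/
theorem ne2PlusOperatorM1_fullGM₂_v1XS (hd1 : 1 ≤ d) (hLodd : Odd L) (hL2 : 2 ≤ L) (hL : Odd L ∧ 1 < L) {b : ℝ} (hb : 0 < b) (c35 : ℝ) (hc35 : 0 < c35) :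
    NE2PlusOperatorM1 c35 (fgInstanceV1GS d 𝔄 ι hL) (fgFamilyV1XS d 𝔄 ι e hL b) :=
  ne2PlusOperatorM1_of_unsized d 𝔄 ι hL c35 _ _ (fun j B δ γ A h => (etaRateIneq342_fgFamilyV1XS_iff d 𝔄 ι e hL b j B δ γ A).mpr h)
    (ne2PlusOperatorM1_fullGM₂_v1X d 𝔄 ι e hd1 hLodd hL2 hL hb c35 hc35)

/-- ★★★ **NE2⁺ OPERATOR LAYER IN THE PRINTED-TEMPLATE SHAPE ON THE SIZED FAMILY — `v1X`**: `T4EtaRate.NE2PlusOperator c₃₅ (fgInstanceV1GS …) (fgFamilyV1XS …)`, on a family where the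
guard `M₅ ≤ gf.M` is LIVE (`fgInstanceV1GS_cofinal`, `not_exists_gf_M_lt_fgInstanceV1GS`): NOT obtainable by a bounded-`M` witness. [cite: Balaban1985BackgroundPropagators, Thm 3.1
(3.42) p.397 + Thm 3.14 pp.426–427 (template)] -/
theorem ne2PlusOperator_fullGM₂_v1XS (hd1 : 1 ≤ d) (hLodd : Odd L) (hL2 : 2 ≤ L) (hL : Odd L ∧ 1 < L) {b : ℝ} (hb : 0 < b) (c35 : ℝ) (hc35 : 0 < c35) :
    NE2PlusOperator c35 (fgInstanceV1GS d 𝔄 ι hL) (fgFamilyV1XS d 𝔄 ι e hL b) :=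
  (ne2PlusOperatorM1_fullGM₂_v1XS d 𝔄 ι e hd1 hLodd hL2 hL hb c35 hc35).ne2PlusOperator

/-- ★★★ **GUARD-FREE SHAPE ON THE SIZED FAMILY — covariant entries 1, 3 (`v1XC`, FILE 35 transported).** [cite: Balaban1985BackgroundPropagators, Thm 3.1 (3.42) p.397 + Thm 3.14
pp.426–427 (template)] -/
theorem ne2PlusOperatorM1_fullGM₂_v1XCS (hd1 : 1 ≤ d) (hLodd : Odd L) (hL2 : 2 ≤ L) (hL : Odd L ∧ 1 < L) {b : ℝ} (hb : 0 < b) (c35 : ℝ) (hc35 : 0 < c35) :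
    NE2PlusOperatorM1 c35 (fgInstanceV1GS d 𝔄 ι hL) (fgFamilyV1XCS d 𝔄 ι e hL b) :=
  ne2PlusOperatorM1_of_unsized d 𝔄 ι hL c35 _ _ (fun j B δ γ A h => (etaRateIneq342_fgFamilyV1XCS_iff d 𝔄 ι e hL b j B δ γ A).mpr h)
    (ne2PlusOperatorM1_fullGM₂_v1XC d 𝔄 ι e hd1 hLodd hL2 hL hb c35 hc35)

/-- ★★★ **PRINTED-TEMPLATE SHAPE ON THE SIZED FAMILY — `v1XC`.** [cite: Balaban1985BackgroundPropagators, Thm 3.1 (3.42) p.397 + Thm 3.14 pp.426–427 (template)] -/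
theorem ne2PlusOperator_fullGM₂_v1XCS (hd1 : 1 ≤ d) (hLodd : Odd L) (hL2 : 2 ≤ L) (hL : Odd L ∧ 1 < L) {b : ℝ} (hb : 0 < b) (c35 : ℝ) (hc35 : 0 < c35) :
    NE2PlusOperator c35 (fgInstanceV1GS d 𝔄 ι hL) (fgFamilyV1XCS d 𝔄 ι e hL b) :=
  (ne2PlusOperatorM1_fullGM₂_v1XCS d 𝔄 ι e hd1 hLodd hL2 hL hb c35 hc35).ne2PlusOperator

/-- ★★★ **GUARD-FREE SHAPE ON THE SIZED FAMILY — all four entries covariant (`v1XA`, FILE 38 transported).** [cite: Balaban1985BackgroundPropagators, Thm 3.1 (3.42) p.397 +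
Thm 3.14 pp.426–427 (template)] -/
theorem ne2PlusOperatorM1_fullGM₂_v1XAS (hd1 : 1 ≤ d) (hLodd : Odd L) (hL2 : 2 ≤ L) (hL : Odd L ∧ 1 < L) {b : ℝ} (hb : 0 < b) (c35 : ℝ) (hc35 : 0 < c35) :
    NE2PlusOperatorM1 c35 (fgInstanceV1GS d 𝔄 ι hL) (fgFamilyV1XAS d 𝔄 ι e hL b) :=
  ne2PlusOperatorM1_of_unsized d 𝔄 ι hL c35 _ _ (fun j B δ γ A h => (etaRateIneq342_fgFamilyV1XAS_iff d 𝔄 ι e hL b j B δ γ A).mpr h)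
    (ne2PlusOperatorM1_fullGM₂_v1XA d 𝔄 ι e hd1 hLodd hL2 hL hb c35 hc35)

/-- ★★★ **PRINTED-TEMPLATE SHAPE ON THE SIZED FAMILY — `v1XA`.** [cite: Balaban1985BackgroundPropagators, Thm 3.1 (3.42) p.397 + Thm 3.14 pp.426–427 (template)] -/
theorem ne2PlusOperator_fullGM₂_v1XAS (hd1 : 1 ≤ d) (hLodd : Odd L) (hL2 : 2 ≤ L) (hL : Odd L ∧ 1 < L) {b : ℝ} (hb : 0 < b) (c35 : ℝ) (hc35 : 0 < c35) :
    NE2PlusOperator c35 (fgInstanceV1GS d 𝔄 ι hL) (fgFamilyV1XAS d 𝔄 ι e hL b) :=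
  (ne2PlusOperatorM1_fullGM₂_v1XAS d 𝔄 ι e hd1 hLodd hL2 hL hb c35 hc35).ne2PlusOperator

/-- `d = 4` (`Fin (3+1)`): the three sized printed-template statements together with the liveness of the guard. [cite: Balaban1985BackgroundPropagators, Thm 3.1 (3.42) p.397 +
Thm 3.14 pp.426–427 (template)] -/
theorem ne2PlusOperator_fullGM₂_sized_dim4 (hLodd : Odd L) (hL2 : 2 ≤ L) (hL : Odd L ∧ 1 < L) {b : ℝ} (hb : 0 < b) (c35 : ℝ) (hc35 : 0 < c35) :
    NE2PlusOperator c35 (fgInstanceV1GS 3 𝔄 ι hL) (fgFamilyV1XS 3 𝔄 ι e hL b) ∧ NE2PlusOperator c35 (fgInstanceV1GS 3 𝔄 ι hL) (fgFamilyV1XCS 3 𝔄 ι e hL b) ∧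
      NE2PlusOperator c35 (fgInstanceV1GS 3 𝔄 ι hL) (fgFamilyV1XAS 3 𝔄 ι e hL b) ∧
      (∀ (ν : Fin 4) (M₅ : ℝ) (k₀ : ℕ), ∃ j : TGIndexS × Fin 4, j.2 = ν ∧ M₅ ≤ (fgInstanceV1GS 3 𝔄 ι hL j).gf.M ∧ k₀ ≤ (fgInstanceV1GS 3 𝔄 ι hL j).gc.k) :=
  ⟨ne2PlusOperator_fullGM₂_v1XS 3 𝔄 ι e (by norm_num) hLodd hL2 hL hb c35 hc35, ne2PlusOperator_fullGM₂_v1XCS 3 𝔄 ι e (by norm_num) hLodd hL2 hL hb c35 hc35,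
    ne2PlusOperator_fullGM₂_v1XAS 3 𝔄 ι e (by norm_num) hLodd hL2 hL hb c35 hc35, fgInstanceV1GS_cofinal 3 𝔄 ι hL⟩

end Transport


/-! ## §4 Teeth: the guard-free shape and the sized printed-template shape are FALSIFIABLE (a kernel family violating them exists); the `M ≡ 1` printed-template shape is not -/

section Teeth

variable {L : ℕ} [NeZero L]
variable (d) (𝔄 : Type) [NormedRing 𝔄] [NormedAlgebra ℝ 𝔄] [CompleteSpace 𝔄] (ι : Type) [Fintype ι] [DecidableEq ι] [Nonempty ι]

/-- THE CONSTANT-ONE TEST FAMILY on a [B9] geometry∕carrier: all four sup entries `≡ 1`, everything else `0` (a bookkeeping witness, not an operator of the paper). [bookkeeping] -/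
def constOneFamily (g : B9.Geometry) (B : B9.Backgrounds) : B9.KernelFamily g B :=
  ⟨fun _ _ _ _ => 1, fun _ _ _ _ => 0, fun _ _ _ => 0, fun _ _ _ _ => 0, fun _ _ _ _ => 0, fun _ _ _ _ => 0⟩

/-- On a realised operator geometry `opGeo g X blk` with a site, the constant-one family violates `EtaRateIneq342` for EVERY `(B₀, δ₀, γ)` and every configuration: test it on the zero
argument `λ = 0` (supported in every cube, `sup |λ| = 0`), where (3.42) would demand `1 ≤ 0` (stated as `… → g.Site → False`). [bookkeeping] -/
theorem not_etaRateIneq342_constOne {g : B6.Geometry} {X : Type} [Fintype X] {blk : X → g.Site} {B : B9.Backgrounds} {B₀ δ₀ γ : ℝ} {U : B.Cfg}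
    (h : EtaRateIneq342 (constOneFamily (opGeo g X blk) B) B₀ δ₀ γ U) (y : g.Site) : False := by
  have h1 := h 3 (0 : X → ℝ) y y (fun _ _ => rfl)
  have h0 : (opGeo g X blk).supNorm (0 : X → ℝ) = 0 := by
    show (⨆ x : X, |(0 : X → ℝ) x|) = 0
    simp only [Pi.zero_apply, abs_zero, Real.iSup_const_zero]
  rw [h0, mul_zero] at h1
  exact absurd h1 (by norm_num [constOneFamily])

omit [CompleteSpace 𝔄] [DecidableEq ι] [Nonempty ι] in
/-- **CONTRAST (the flagged vacuity, by name)**: on FILE 27's `M ≡ 1` family the PRINTED-TEMPLATE shape holds for EVERY kernel family — n15-w2's (J2) `ne2PlusOperator_of_gf_M_lt` at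
`M₅ := 2` (ref-F's probe). [bookkeeping] -/
theorem ne2PlusOperator_fgInstanceV1G_any (hL : Odd L ∧ 1 < L) (c35 : ℝ) (Kd : ∀ i, B9.KernelFamily (fgInstanceV1G d 𝔄 ι hL i).gc (fgInstanceV1G d 𝔄 ι hL i).Bf) :
    NE2PlusOperator c35 (fgInstanceV1G d 𝔄 ι hL) Kd :=
  PairedFamilyGuard.ne2PlusOperator_of_gf_M_lt c35 _ Kd (M₅ := 2) two_pos fun i => by
    rw [show (fgInstanceV1G d 𝔄 ι hL i).gf.M = 1 from rfl]; norm_num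

omit [CompleteSpace 𝔄] [DecidableEq ι] [Nonempty ι] in
/-- ★ **THE GUARD-FREE SHAPE HAS TEETH ON THE `M ≡ 1` FAMILY**: some kernel family (the constant-one test family) VIOLATES `NE2PlusOperatorM1` there (`c₃₅ ≥ 0`, so that the zero
field is regular): FILE 39's theorems are not instances of a tautology. [bookkeeping] -/
theorem exists_not_ne2PlusOperatorM1_fgInstanceV1G (hL : Odd L ∧ 1 < L) {c35 : ℝ} (hc35 : 0 ≤ c35) :
    ∃ Kd : ∀ i, B9.KernelFamily (fgInstanceV1G d 𝔄 ι hL i).gc (fgInstanceV1G d 𝔄 ι hL i).Bf, ¬ NE2PlusOperatorM1 c35 (fgInstanceV1G d 𝔄 ι hL) Kd := by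
  refine ⟨fun i => constOneFamily _ _, ?_⟩
  rintro ⟨δ₀, a₀, B₀, γ, -, ha₀, -, -, H⟩
  let i : TGIndex × Fin (d + 1) := (⟨1, 1, le_rfl, 0⟩, 0)
  have hM : (fgInstanceV1G d 𝔄 ι hL i).gf.M = 1 := rfl
  have hreg := reg335_fgInstanceV1G_const d 𝔄 ι hL i hc35 ha₀.le (0 : 𝔄) (by rw [norm_zero]; positivity)
  exact not_etaRateIneq342_constOne (H i a₀ ha₀ (by rw [hM, one_mul]) _ hreg) (fun _ => 0)

omit [CompleteSpace 𝔄] [DecidableEq ι] [Nonempty ι] in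
/-- ★★ **ON THE SIZED FAMILY EVEN THE PRINTED-TEMPLATE SHAPE HAS TEETH**: some kernel family VIOLATES `NE2PlusOperator c₃₅ (fgInstanceV1GS …) ·` (`c₃₅ ≥ 0`) — whatever `M₅` a proof
offers, the family has an index of size `≥ M₅` (cofinality), where the zero field at `α₀ := a₀/M` is regular and the constant-one family fails (3.42).  So §3's `ne2PlusOperator_fullGM₂_v1XS`
∕ `…CS` ∕ `…AS` certify an estimate at the type level. [bookkeeping] -/
theorem exists_not_ne2PlusOperator_fgInstanceV1GS (hL : Odd L ∧ 1 < L) {c35 : ℝ} (hc35 : 0 ≤ c35) :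
    ∃ Kd : ∀ j, B9.KernelFamily (fgInstanceV1GS d 𝔄 ι hL j).gc (fgInstanceV1GS d 𝔄 ι hL j).Bf, ¬ NE2PlusOperator c35 (fgInstanceV1GS d 𝔄 ι hL) Kd := by
  refine ⟨fun j => constOneFamily _ _, ?_⟩
  rintro ⟨M₅, δ₀, a₀, B₀, γ, -, -, ha₀, -, -, H⟩
  obtain ⟨j, -, hjM, -⟩ := fgInstanceV1GS_cofinal d 𝔄 ι hL 0 M₅ 0
  have hMS : (fgInstanceV1GS d 𝔄 ι hL j).gf.M = j.1.Msz := rfl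
  have hM0 : 0 < j.1.Msz := lt_of_lt_of_le one_pos j.1.one_le_Msz
  have hα₀ : 0 < a₀ / j.1.Msz := div_pos ha₀ hM0
  have hwin : (fgInstanceV1GS d 𝔄 ι hL j).gf.M * (a₀ / j.1.Msz) ≤ a₀ := by rw [hMS, mul_div_cancel₀ _ hM0.ne']
  have hreg := reg335_fgInstanceV1GS_const d 𝔄 ι hL j hc35 hα₀.le (0 : 𝔄) (by rw [norm_zero]; positivity)
  exact not_etaRateIneq342_constOne (H j hjM _ hα₀ hwin _ hreg) (fun _ => 0)

omit [CompleteSpace 𝔄] [DecidableEq ι] [Nonempty ι] in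
/-- … hence the guard-free shape has teeth on the sized family too (it implies the printed-template shape). [bookkeeping] -/
theorem exists_not_ne2PlusOperatorM1_fgInstanceV1GS (hL : Odd L ∧ 1 < L) {c35 : ℝ} (hc35 : 0 ≤ c35) :
    ∃ Kd : ∀ j, B9.KernelFamily (fgInstanceV1GS d 𝔄 ι hL j).gc (fgInstanceV1GS d 𝔄 ι hL j).Bf, ¬ NE2PlusOperatorM1 c35 (fgInstanceV1GS d 𝔄 ι hL) Kd := by
  obtain ⟨Kd, hKd⟩ := exists_not_ne2PlusOperator_fgInstanceV1GS d 𝔄 ι hL hc35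
  exact ⟨Kd, fun h => hKd h.ne2PlusOperator⟩

end Teeth

end Summit.QuantumFields.YangMills.BalabanUVNodes.N15.BackgroundLayer
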